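import Mathlib
import Summits.Ventures.PercRepro2.TypedTwoTerminal
import Summits.Ventures.PercRepro2.TypedMaskConn

/-!
# The part-elimination identity (blind cell PercRepro2, p2 g3, 2026-08-25) — every unmarked part
is a nonnegative integer combination of MASKED counts of the base

For ANY typed edge set `L ⊆ F` and any set `I` of unmarked vertices whose typed edges all lie in
`L`, the typed base of the crux kernel is the sum, over the typed placements of `L`, of the typed
base of `F ∖ L` read in the base's open graph augmented, copy by copy, by the TERMINAL RELATION of
the placement (the pairs of vertices off `I` joined through the placed edges) — `maskCount`, the
per-copy clique masks of mine-1 §25's hyperstar language on an arbitrary base. Grouping the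
placements by their relation pattern (`patCountM`, symmetric under the copy permutations):
`typedCount_part : N(B + L) = Σ_π patCountM π · maskCount B π` (`π` a triple of pair sets).
The two-terminal and root-bundle identities are the cases in which the surviving patterns are
realised by typed virtual edges; in general the orbit sums `Σ_{σ} maskCount B (σπ)` are the typed
hyper-objects the Props of the hyperstar program quantify over.
-/

namespace Summit.Ventures.PercRepro2

namespace CovForm

namespace TypedRed

namespace Mask

open TwoTerm OneTyped

/-! ## Placements grouped by an arbitrary pattern -/

section Fiber

open Classical

variable {E : Type*} [Fintype E] [DecidableEq E] {β : Type*} [Fintype β] [DecidableEq β]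

/-- The number of placements of `L` whose copies have the pattern `π` under `g`. -/
def fiberCount (L : Finset E) (τ : E → ℕ) (g : Config E → β) (π : β × β × β) : ℕ :=
  ((placements L τ).filter fun p => (g p.1, g p.2.1, g p.2.2) = π).card

omit [Fintype β] in
/-- The fibre count is symmetric under exchanging the first two copies. -/
lemma fiberCount_swap12 (L : Finset E) (τ : E → ℕ) (g : Config E → β) (p q r : β) :
    fiberCount L τ g (q, p, r) = fiberCount L τ g (p, q, r) := by
  unfold fiberCount
  refine Finset.card_nbij' (fun x => (x.2.1, x.1, x.2.2)) (fun x => (x.2.1, x.1, x.2.2)) ?_ ?_ ?_ ?_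
  · rintro ⟨a, b, c⟩ h
    rw [Finset.mem_coe, Finset.mem_filter, mem_placements] at h ⊢
    simp only [Prod.mk.injEq] at h ⊢
    exact ⟨⟨⟨h.1.1.2.1, h.1.1.1, h.1.1.2.2⟩, isPlacement_swap12.2 h.1.2⟩, h.2.2.1, h.2.1, h.2.2.2⟩
  · rintro ⟨a, b, c⟩ h
    rw [Finset.mem_coe, Finset.mem_filter, mem_placements] at h ⊢
    simp only [Prod.mk.injEq] at h ⊢
    exact ⟨⟨⟨h.1.1.2.1, h.1.1.1, h.1.1.2.2⟩, isPlacement_swap12.2 h.1.2⟩, h.2.2.1, h.2.1, h.2.2.2⟩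
  · rintro ⟨a, b, c⟩ _; rfl
  · rintro ⟨a, b, c⟩ _; rfl

omit [Fintype β] in
/-- The fibre count is symmetric under exchanging the last two copies. -/
lemma fiberCount_swap23 (L : Finset E) (τ : E → ℕ) (g : Config E → β) (p q r : β) :
    fiberCount L τ g (p, r, q) = fiberCount L τ g (p, q, r) := by
  unfold fiberCount
  refine Finset.card_nbij' (fun x => (x.1, x.2.2, x.2.1)) (fun x => (x.1, x.2.2, x.2.1)) ?_ ?_ ?_ ?_
  · rintro ⟨a, b, c⟩ h
    rw [Finset.mem_coe, Finset.mem_filter, mem_placements] at h ⊢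
    simp only [Prod.mk.injEq] at h ⊢
    exact ⟨⟨⟨h.1.1.1, h.1.1.2.2, h.1.1.2.1⟩, isPlacement_swap23.2 h.1.2⟩, h.2.1, h.2.2.2, h.2.2.1⟩
  · rintro ⟨a, b, c⟩ h
    rw [Finset.mem_coe, Finset.mem_filter, mem_placements] at h ⊢
    simp only [Prod.mk.injEq] at h ⊢
    exact ⟨⟨⟨h.1.1.1, h.1.1.2.2, h.1.1.2.1⟩, isPlacement_swap23.2 h.1.2⟩, h.2.1, h.2.2.2, h.2.2.1⟩
  · rintro ⟨a, b, c⟩ _; rfl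
  · rintro ⟨a, b, c⟩ _; rfl

variable {R : Type*} [CommRing R]

/-- A placement sum of a function of the pattern, grouped by the pattern. -/
lemma sum_placements_fiber (L : Finset E) (τ : E → ℕ) (g : Config E → β) (T : β → β → β → R) :
    (∑ a ∈ suppL L, ∑ b ∈ suppL L, ∑ c ∈ suppL L,
        if IsPlacement L τ a b c then T (g a) (g b) (g c) else 0) =
      ∑ π : β × β × β, (fiberCount L τ g π : R) * T π.1 π.2.1 π.2.2 := by
  have h1 : (∑ a ∈ suppL L, ∑ b ∈ suppL L, ∑ c ∈ suppL L,
      if IsPlacement L τ a b c then T (g a) (g b) (g c) else 0) =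
      ∑ p ∈ placements L τ, T (g p.1) (g p.2.1) (g p.2.2) := by
    unfold placements
    rw [Finset.sum_filter, Finset.sum_product]
    refine Finset.sum_congr rfl fun a _ => ?_
    rw [Finset.sum_product]
  rw [h1, ← Finset.sum_fiberwise_of_maps_to (t := (Finset.univ : Finset (β × β × β)))
    (g := fun p => (g p.1, g p.2.1, g p.2.2)) (fun _ _ => Finset.mem_univ _)]
  refine Finset.sum_congr rfl fun π _ => ?_
  rw [Finset.sum_congr rfl fun p hp => by
    have := (Finset.mem_filter.1 hp).2
    rw [show T (g p.1) (g p.2.1) (g p.2.2) = T π.1 π.2.1 π.2.2 by rw [← this]]]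
  rw [Finset.sum_const, nsmul_eq_mul]
  rfl

end Fiber

/-! ## Masked counts -/

section MaskCount

open Classical

variable {V : Type*} [Fintype V] [DecidableEq V] {E : Type*} [Fintype E] [DecidableEq E]

/-- The ordered pairs of a relation. -/
noncomputable def pairsOf (r : V → V → Prop) : Finset (V × V) := Finset.univ.filter fun xy => r xy.1 xy.2

/-- The relation of a set of ordered pairs. -/
def relOf (P : Finset (V × V)) (x y : V) : Prop := (x, y) ∈ P

omit [DecidableEq V] in
/-- A relation and its pair set give the same graph. -/
lemma fromRel_relOf_pairsOf (r : V → V → Prop) :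
    SimpleGraph.fromRel (relOf (pairsOf r)) = SimpleGraph.fromRel r := by
  ext x y
  simp [SimpleGraph.fromRel_adj, relOf, pairsOf]

/-- The terminal pairs of a placement. -/
noncomputable def tPairs (ends : E → Sym2 V) (I : Set V) (a : Config E) : Finset (V × V) :=
  pairsOf (tRel ends I a)

variable {R : Type*} [Field R]

/-- **The masked typed count**: the typed count of the crux kernel read, copy by copy, in the open
graph augmented by a set of pairs (forced-open virtual edges). -/
noncomputable def maskCount (F : Finset E) (z : Config E) (τ : E → ℕ) (ends : E → Sym2 V)
    (o a₁ a₂ a₃ b : V) (P₁ P₂ P₃ : Finset (V × V)) : R :=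
  typedCount F z τ fun x y w =>
    ((KB (stG o a₁ a₂ a₃ b (openGraph ends x ⊔ SimpleGraph.fromRel (relOf P₁)))
      (stG o a₁ a₂ a₃ b (openGraph ends y ⊔ SimpleGraph.fromRel (relOf P₂)))
      (stG o a₁ a₂ a₃ b (openGraph ends w ⊔ SimpleGraph.fromRel (relOf P₃))) : ℤ) : R)

/-- The number of placements of `L` with a given terminal-pair pattern. -/
noncomputable def patCountM (ends : E → Sym2 V) (I : Set V) (L : Finset E) (τ : E → ℕ)
    (π : Finset (V × V) × Finset (V × V) × Finset (V × V)) : ℕ :=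
  fiberCount L τ (tPairs ends I) π

/-- The pattern count is symmetric under exchanging the first two copies. -/
lemma patCountM_swap12 (ends : E → Sym2 V) (I : Set V) (L : Finset E) (τ : E → ℕ)
    (p q r : Finset (V × V)) :
    patCountM ends I L τ (q, p, r) = patCountM ends I L τ (p, q, r) :=
  fiberCount_swap12 L τ (tPairs ends I) p q r

/-- The pattern count is symmetric under exchanging the last two copies. -/
lemma patCountM_swap23 (ends : E → Sym2 V) (I : Set V) (L : Finset E) (τ : E → ℕ)
    (p q r : Finset (V × V)) :
    patCountM ends I L τ (p, r, q) = patCountM ends I L τ (p, q, r) :=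
  fiberCount_swap23 L τ (tPairs ends I) p q r

/-- **The part-elimination identity**: the typed base of the crux kernel is the pattern-weighted
sum of the masked counts of the base `F ∖ L`, for any typed edge set `L ⊆ F` and any set `I` of
unmarked vertices whose typed edges all lie in `L`. -/
theorem typedCount_part (ends : E → Sym2 V) (o a₁ a₂ a₃ b : V) {I : Set V}
    (hI : ∀ x ∈ I, x ≠ o ∧ x ≠ a₁ ∧ x ≠ a₂ ∧ x ≠ a₃ ∧ x ≠ b) {L : Finset E} {F : Finset E}
    (hLF : L ⊆ F) (z : Config E) (τ : E → ℕ)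
    (hcl : ∀ e, e ∉ L → (∃ x ∈ I, x ∈ ends e) → e ∉ F ∧ z e = false) :
    typedCount F z τ (K3 ends o a₁ a₂ a₃ b : Config E → Config E → Config E → R) =
      ∑ π : Finset (V × V) × Finset (V × V) × Finset (V × V),
        (patCountM ends I L τ π : R) *
          maskCount (F \ L) (offL L z) τ ends o a₁ a₂ a₃ b π.1 π.2.1 π.2.2 := by
  rw [typedCount_split_finset F L hLF z τ]
  -- the kernel at a placement is the masked kernel
  have hK : ∀ a b' c : Config E, a ∈ suppL L → b' ∈ suppL L → c ∈ suppL L →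
      typedCount (F \ L) (offL L z) τ (fun x y w => (K3 ends o a₁ a₂ a₃ b
        (patchL L a x) (patchL L b' y) (patchL L c w) : R)) =
      (maskCount (F \ L) (offL L z) τ ends o a₁ a₂ a₃ b (tPairs ends I a) (tPairs ends I b')
        (tPairs ends I c) : R) := by
    intro a b' c ha hb hc
    unfold maskCount
    refine typedCount_congr_K_on _ _ _ fun x y w hxyw _ => ?_
    have hsupp : ∀ a' x' : Config E, (∀ e, e ∉ L → a' e = false) →
        (∀ e, e ∉ F \ L → x' e = offL L z e) →
        st ends o a₁ a₂ a₃ b (patchL L a' x') =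
          stG o a₁ a₂ a₃ b (openGraph ends x' ⊔ SimpleGraph.fromRel (relOf (tPairs ends I a'))) := by
      intro a' x' ha' hx'
      have hxL : ∀ e ∈ L, x' e = false := fun e he => by
        have := hx' e fun h => (Finset.mem_sdiff.1 h).2 he
        rwa [offL_of_mem he] at this
      have hcl' : ∀ e, e ∉ L → (∃ u ∈ I, u ∈ ends e) → patchL L a' x' e = false :=
        fun e heL hu => by
          obtain ⟨heF, hze⟩ := hcl e heL hu
          rw [patchL_of_not_mem heL, hx' e fun h => heF (Finset.mem_sdiff.1 h).1,
            offL_of_not_mem heL, hze]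
      rw [st_mask ends o a₁ a₂ a₃ b hI L (patchL L a' x') hcl', maskGraph_patchL ends I ha' hxL,
        tPairs, fromRel_relOf_pairsOf]
    rw [K3_eq_KB, hsupp a x (mem_suppL.1 ha) fun e he => (hxyw e he).1,
      hsupp b' y (mem_suppL.1 hb) fun e he => (hxyw e he).2.1,
      hsupp c w (mem_suppL.1 hc) fun e he => (hxyw e he).2.2]
  have hmid : (∑ a ∈ suppL L, ∑ b' ∈ suppL L, ∑ c ∈ suppL L,
      if IsPlacement L τ a b' c then typedCount (F \ L) (offL L z) τ
        (fun x y w => (K3 ends o a₁ a₂ a₃ b (patchL L a x) (patchL L b' y) (patchL L c w) : R))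
      else 0) =
      ∑ a ∈ suppL L, ∑ b' ∈ suppL L, ∑ c ∈ suppL L,
        if IsPlacement L τ a b' c then
          (maskCount (F \ L) (offL L z) τ ends o a₁ a₂ a₃ b (tPairs ends I a) (tPairs ends I b')
            (tPairs ends I c) : R) else 0 :=
    Finset.sum_congr rfl fun a ha => Finset.sum_congr rfl fun b' hb =>
      Finset.sum_congr rfl fun c hc => by
        by_cases hP : IsPlacement L τ a b' c
        · rw [if_pos hP, if_pos hP, hK a b' c ha hb hc]
        · rw [if_neg hP, if_neg hP]
  rw [hmid]
  exact sum_placements_fiber L τ (tPairs ends I)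
    (fun P₁ P₂ P₃ => maskCount (F \ L) (offL L z) τ ends o a₁ a₂ a₃ b P₁ P₂ P₃)

end MaskCount

/-! ## The copy-symmetrised form: the orbit objects -/

section Sym

variable {β : Type*} [Fintype β] [DecidableEq β]

/-- The exchange of the first two copies, as an equivalence of pattern triples. -/
def sw12 : β × β × β ≃ β × β × β where
  toFun x := (x.2.1, x.1, x.2.2)
  invFun x := (x.2.1, x.1, x.2.2)
  left_inv := fun _ => rfl
  right_inv := fun _ => rfl

/-- The exchange of the last two copies. -/
def sw23 : β × β × β ≃ β × β × β where
  toFun x := (x.1, x.2.2, x.2.1)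
  invFun x := (x.1, x.2.2, x.2.1)
  left_inv := fun _ => rfl
  right_inv := fun _ => rfl

/-- The sum of a function over the six copy-permutations of a pattern: the ORBIT OBJECT of the
pattern. -/
def symSum {R : Type*} [AddCommMonoid R] (T : β × β × β → R) (π : β × β × β) : R :=
  T π + T (sw12 π) + T (sw23 π) + T (sw12 (sw23 π)) + T (sw23 (sw12 π)) +
    T (sw12 (sw23 (sw12 π)))

variable {R : Type*} [CommRing R]

omit [DecidableEq β] in
/-- A weighted sum with copy-symmetric weights is unchanged by permuting the copies of the
summand. -/
lemma sum_weight_perm (c : β × β × β → R) (h12 : ∀ π, c (sw12 π) = c π)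
    (h23 : ∀ π, c (sw23 π) = c π) (T : β × β × β → R) :
    (∑ π, c π * T (sw12 π)) = ∑ π, c π * T π ∧ (∑ π, c π * T (sw23 π)) = ∑ π, c π * T π ∧
      (∑ π, c π * T (sw12 (sw23 π))) = ∑ π, c π * T π ∧
      (∑ π, c π * T (sw23 (sw12 π))) = ∑ π, c π * T π ∧
      (∑ π, c π * T (sw12 (sw23 (sw12 π)))) = ∑ π, c π * T π := by
  have e12 : ∀ (U : β × β × β → R), (∑ π, c π * U (sw12 π)) = ∑ π, c π * U π := fun U => by
    rw [Fintype.sum_equiv sw12 (fun π => c π * U (sw12 π)) (fun π => c (sw12.symm π) * U π)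
      (fun π => by rw [Equiv.symm_apply_apply])]
    exact Finset.sum_congr rfl fun π _ => by
      have hc : c (sw12.symm π) = c π := h12 π
      rw [hc]
  have e23 : ∀ (U : β × β × β → R), (∑ π, c π * U (sw23 π)) = ∑ π, c π * U π := fun U => by
    rw [Fintype.sum_equiv sw23 (fun π => c π * U (sw23 π)) (fun π => c (sw23.symm π) * U π)
      (fun π => by rw [Equiv.symm_apply_apply])]
    exact Finset.sum_congr rfl fun π _ => by
      have hc : c (sw23.symm π) = c π := h23 π
      rw [hc]
  refine ⟨e12 T, e23 T, ?_, ?_, ?_⟩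
  · exact (e23 (fun x => T (sw12 x))).trans (e12 T)
  · exact (e12 (fun x => T (sw23 x))).trans (e23 T)
  · exact (e12 (fun x => T (sw12 (sw23 x)))).trans ((e23 (fun x => T (sw12 x))).trans (e12 T))

omit [DecidableEq β] in
/-- **The copy-symmetrised weighted sum**: with copy-symmetric weights, six times the weighted sum
is the weighted sum of the orbit objects. -/
theorem sum_weight_symSum (c : β × β × β → R) (h12 : ∀ π, c (sw12 π) = c π)
    (h23 : ∀ π, c (sw23 π) = c π) (T : β × β × β → R) :
    (6 : R) * ∑ π, c π * T π = ∑ π, c π * symSum T π := by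
  obtain ⟨e1, e2, e3, e4, e5⟩ := sum_weight_perm c h12 h23 T
  simp only [symSum, mul_add, Finset.sum_add_distrib, e1, e2, e3, e4, e5]
  ring

end Sym

section Orbits

open Classical

variable {V : Type*} [Fintype V] [DecidableEq V] {E : Type*} [Fintype E] [DecidableEq E]
variable {R : Type*} [Field R]

/-- **The part-elimination identity in orbit form**: six times the typed base is the
pattern-weighted sum of the ORBIT OBJECTS `symSum` of the masked counts — the copy-symmetrised
typed hyper-objects of mine-1 §25 (a hyperedge of type `k` = one block in exactly `k` copies, the
mixed objects = different blocks in different copies). -/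
theorem typedCount_part_sym (ends : E → Sym2 V) (o a₁ a₂ a₃ b : V) {I : Set V}
    (hI : ∀ x ∈ I, x ≠ o ∧ x ≠ a₁ ∧ x ≠ a₂ ∧ x ≠ a₃ ∧ x ≠ b) {L : Finset E} {F : Finset E}
    (hLF : L ⊆ F) (z : Config E) (τ : E → ℕ)
    (hcl : ∀ e, e ∉ L → (∃ x ∈ I, x ∈ ends e) → e ∉ F ∧ z e = false) :
    (6 : R) * typedCount F z τ (K3 ends o a₁ a₂ a₃ b : Config E → Config E → Config E → R) =
      ∑ π : Finset (V × V) × Finset (V × V) × Finset (V × V),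
        (patCountM ends I L τ π : R) *
          symSum (fun π' => maskCount (F \ L) (offL L z) τ ends o a₁ a₂ a₃ b π'.1 π'.2.1 π'.2.2)
            π := by
  rw [typedCount_part ends o a₁ a₂ a₃ b hI hLF z τ hcl]
  exact sum_weight_symSum (fun π => (patCountM ends I L τ π : R))
    (fun π => by
      obtain ⟨p, q, r⟩ := π
      show ((patCountM ends I L τ (q, p, r) : ℕ) : R) = ((patCountM ends I L τ (p, q, r) : ℕ) : R)
      rw [patCountM_swap12])
    (fun π => by
      obtain ⟨p, q, r⟩ := π
      show ((patCountM ends I L τ (p, r, q) : ℕ) : R) = ((patCountM ends I L τ (p, q, r) : ℕ) : R)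
      rw [patCountM_swap23]) _

/-- **The degree-three elimination** (the corollary the hyperstar program uses): an unmarked
vertex `u` whose typed edges are exactly `e₁, e₂, e₃` is eliminated in favour of the masked counts
of the base, with the pattern counts of its star. -/
theorem typedCount_star3 (ends : E → Sym2 V) (o a₁ a₂ a₃ b : V) {u : V}
    (hu : u ≠ o ∧ u ≠ a₁ ∧ u ≠ a₂ ∧ u ≠ a₃ ∧ u ≠ b) {e₁ e₂ e₃ : E} {F : Finset E}
    (h1 : e₁ ∈ F) (h2 : e₂ ∈ F) (h3 : e₃ ∈ F) (hu1 : u ∈ ends e₁) (hu2 : u ∈ ends e₂)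
    (hu3 : u ∈ ends e₃) (z : Config E) (τ : E → ℕ)
    (hdeg : ∀ e, u ∈ ends e → e = e₁ ∨ e = e₂ ∨ e = e₃ ∨ (e ∉ F ∧ z e = false)) :
    typedCount F z τ (K3 ends o a₁ a₂ a₃ b : Config E → Config E → Config E → R) =
      ∑ π : Finset (V × V) × Finset (V × V) × Finset (V × V),
        (patCountM ends {u} {e₁, e₂, e₃} τ π : R) *
          maskCount (F \ {e₁, e₂, e₃}) (offL {e₁, e₂, e₃} z) τ ends o a₁ a₂ a₃ b π.1 π.2.1 π.2.2 := by
  refine typedCount_part ends o a₁ a₂ a₃ b (I := {u}) (fun x hx => ?_) ?_ z τ ?_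
  · rw [Set.mem_singleton_iff] at hx; subst hx; exact hu
  · intro e he
    simp only [Finset.mem_insert, Finset.mem_singleton] at he
    rcases he with rfl | rfl | rfl <;> assumption
  · intro e heL hx
    obtain ⟨x, hx, hxe⟩ := hx
    rw [Set.mem_singleton_iff] at hx
    subst hx
    rcases hdeg e hxe with rfl | rfl | rfl | h
    · exact absurd (by simp) heL
    · exact absurd (by simp) heL
    · exact absurd (by simp) heL
    · exact h

end Orbits

end Mask

end TypedRed

end CovForm

end Summit.Ventures.PercRepro2
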